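import Literature.Barriers.AnomalousDissipation.GravestModeLaminarAttractorExcess
import Literature.Barriers.AnomalousDissipation.GravestModeLaminarAttractorShell
import Literature.Barriers.AnomalousDissipation.GravestModeLaminarAttractorGalerkin
import Literature.Analysis.FluidPDE.NSUniqueness2D
import Literature.Analysis.FluidPDE.NSUniqueness2DProofs
import HarnessLib

/-!
# Marchioro's trivial attractor: assembly of `Marchioro1986_globalAttraction`
(sibling proof file of `Literature/Barriers/AnomalousDissipation/GravestModeLaminarAttractor`)

`Marchioro1986_globalAttraction` (Marchioro, CMP 105 (1986), Theorem; Foias–Manley–Rosa–Temam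
2001, Ch. III (3.35), App. III.A.4) quantifies over *every* global Leray–Hopf solution of the
2-D Navier–Stokes equations on `𝕋²` with first-mode forcing. The printed proof (FMRT App.
III.A.4) is decomposed in `GravestModeLaminarAttractorExcess` into the two named halves
`firstMode_exists_lerayHopf_enstrophyExcess_tendsto_zero` ((A.32)–(A.33), existence form) and
`firstMode_tendsto_laminarState_of_enstrophyExcess_tendsto_zero` ((A.34) ⇒ (3.35)); the passage
from "the solution" of the book to "every Leray–Hopf solution" is 2-D uniqueness,
`NS.lions_prodi_uniqueness_torus2` (`Literature.Analysis.FluidPDE.NSUniqueness2D`; FMRT Ch. II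
Thm. 7.3). This file **proves the assembly** `Marchioro1986_globalAttraction_of`: the three
facts imply `Marchioro1986_globalAttraction` (an arbitrary Leray–Hopf solution agrees a.e., at
every positive time, with the solution of half 1, to which half 2 applies). When the three
sub-facts are theorems, `Marchioro1986_globalAttraction_holds` is this assembly applied to them.

## References

* C. Marchioro, Comm. Math. Phys. 105 (1986) 99–106, Theorem.
* C. Foias, O. Manley, R. Rosa, R. Temam, *Navier–Stokes Equations and Turbulence*, CUP 2001,
  Ch. II Thm. 7.3 (PDF p. 72); Ch. III (3.35) (p. 164); App. III.A.4 (pp. 178–180).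
-/

open MeasureTheory Set Filter Topology UnitAddTorus
open scoped ENNReal NNReal

noncomputable section

namespace Literature.Barriers.AnomalousDissipation

/-! ### The assembly -/

/-- **Assembly of Marchioro's theorem from the three named sub-facts** (FMRT 2001, Ch. III
(3.35) with App. III.A.4 and Ch. II Thm. 7.3). Given 2-D uniqueness of Leray–Hopf solutions on
`𝕋²`, the existence of a Leray–Hopf solution with decaying enstrophy excess (half 1) and the
first-shell ODE argument (half 2), *every* global Leray–Hopf solution with first-mode forcing
converges in `L²` to the laminar state: it agrees almost everywhere, at every positive time,
with the solution of half 1. Real proof. [cite: FoiasManleyRosaTemam2001, Ch. III (3.35) and App. III.A.4] -/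
theorem Marchioro1986_globalAttraction_of (hU : Literature.Analysis.FluidPDE.lions_prodi_uniqueness_torus2)
    (hG : firstMode_exists_lerayHopf_enstrophyExcess_tendsto_zero)
    (hA : firstMode_tendsto_laminarState_of_enstrophyExcess_tendsto_zero) :
    Marchioro1986_globalAttraction := by
  intro α ν hν u₀ hu₀ hdiv hmean u hu
  obtain ⟨w, hw, hbound, hE⟩ := hG α ν hν u₀ hu₀ hdiv hmean
  have hconv := hA α ν hν u₀ hu₀ hdiv hmean w hw hbound hE
  -- `u(t) = w(t)` a.e. for every `t > 0`, by 2-D uniqueness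
  have hae : ∀ t, 0 < t → u t =ᵐ[volume] w t := fun t ht =>
    hU.global hν (aestronglyMeasurable_stLift_marchioroForce α _)
      (fun T _ => lintegral_enorm_sq_marchioroForce_lt_top α T) hu₀ hdiv hu hw ht
  refine hconv.congr' ?_
  filter_upwards [eventually_gt_atTop (0 : ℝ)] with t ht
  refine eLpNorm_congr_ae ?_
  filter_upwards [hae t ht] with x hx
  simp only [Pi.sub_apply, hx]

/-! ### The discharge -/

/-- **Marchioro's theorem, proved** (Marchioro, CMP 105 (1986), Theorem; Foias–Manley–Rosa–Temam
2001, Ch. III (3.35) with App. III.A.4 (A.32)–(A.34) and Ch. II Thm. 7.3): for every `α`, every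
`ν > 0` and every mean-free, weakly divergence-free `u₀ ∈ L²(𝕋²)`, every global Leray–Hopf
solution of the 2-D Navier–Stokes equations on the flat unit torus with the first-mode forcing
`f_α` converges in `L²` to the laminar state `f_α/(4π²ν)`, whatever the Reynolds number. The
assembly `Marchioro1986_globalAttraction_of` applied to the three discharged sub-facts:
2-D uniqueness `Literature.Analysis.FluidPDE.lions_prodi_uniqueness_torus2_holds`
(`NSUniqueness2DProofs`), half 1 `firstMode_exists_lerayHopf_enstrophyExcess_tendsto_zero_holds`
(`GravestModeLaminarAttractorGalerkin`: a Leray–Hopf solution with exponentially decaying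
enstrophy excess, from the Hopf–Galerkin scheme) and half 2
`firstMode_tendsto_laminarState_of_enstrophyExcess_tendsto_zero_holds`
(`GravestModeLaminarAttractorShell`: the first-shell ODE argument). [cite: FoiasManleyRosaTemam2001, Ch. III (3.35) and App. III.A.4] -/
theorem Marchioro1986_globalAttraction_holds : Marchioro1986_globalAttraction :=
  Marchioro1986_globalAttraction_of Literature.Analysis.FluidPDE.lions_prodi_uniqueness_torus2_holds
    firstMode_exists_lerayHopf_enstrophyExcess_tendsto_zero_holds
    firstMode_tendsto_laminarState_of_enstrophyExcess_tendsto_zero_holds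

end Literature.Barriers.AnomalousDissipation

end
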